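import Summits.FinalStateConjecture.FinalStateConjecture.Theorems.SwallowTheDatumParametricKerrBurialStubBreathing
import Literature.Geometry.Lorentzian.ModelData
import Literature.Geometry.Lorentzian.InitialDataPullback
import Literature.Geometry.Lorentzian.AFEndBreathingData
import Literature.Geometry.Lorentzian.AFEndUnbreathe
import Literature.Geometry.Lorentzian.AdmissibleDataLocality
import HarnessLib

/-!
# Crux `SwallowTheDatum.UniversalWitnessFamily` (stmt-FinalStateConjecture-10051), line `Sketch`
# (throat-settles-too), stub `stub_sheetBreathing`

The registered stub `stub_sheetBreathing` of the lead's skeleton (`Cruxes/UniversalWitnessFamily/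
Lines/Sketch.lean`, v5), proved verbatim: from a radius-indexed family `P R` (`R > R⋆`) of admissible
SHEET-SHIELDED data on `X` (an open embedding `Φ : {‖y‖ > M'/2} → X` of the isotropic Schwarzschild
exterior sheet with injective differentials and co-compact far zones along which `P R` pulls back
EXACTLY to the time-symmetric exterior data) agreeing with the datum `d` off the far region
`e.far R`, with sections jointly smooth in `(R, x)`, produce the two-parameter family `S (R, t)`, the
one-parameter family `E t` through `d = E 0`, and a marker `(x₀, v₀)` making
`t ↦ h_{E t}(x₀)(v₀, v₀)` injective — the ingredients of the junction lemma
(`Theorems/SwallowTheDatumParametricKerrBurialLine.lean`).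

Construction (breathing; the template is the landed `stub_breathing` of crux 10052,
`Theorems/SwallowTheDatumParametricKerrBurialStubBreathing.lean`, whose generic part is repeated
here word for word): inside the coordinate shell `{R < ‖coord‖ < R⋆}` of the end `e` choose a
coordinate ball (`exists_breathingData_le`) and let `Φ_t = breathe (σ t)` be the breathing
diffeomorphisms of `X` supported in it (`AFEndBreathing`, `AFEndUnbreathe`); set `E t := Φ_t^* d`
and `S (R, t) := Φ_t^* (P R)` (`AFEnd.breatheFamily`). Then `E 0 = d`; the families are jointly
smooth; `S (R, t) = E t` off `e.far R`; the marker is injective (`injective_marker`); `S (R, t)` is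
admissible (vacuum by naturality, the end by `AdmissibleDataLocality`). The only shield-specific
step: **the sheet shield is invariant under pullback by a diffeomorphism** `Θ` with smooth inverse
`Ψ` (`isSheetShielded_comap_of_inverse`): the new sheet chart is `Ψ ∘ Φ`, and
`(Ψ ∘ Φ)^*(Θ^* D) = (Θ ∘ Ψ ∘ Φ)^* D = Φ^* D` is the same exact exterior datum.

References: the route file `Theses/SwallowTheDatum.lean` (item 10051); Lines/Sketch.md; Lee,
*Introduction to Smooth Manifolds* (2013), Ch. 9; O'Neill 1983, Ch. 3; Bray, J. Diff. Geom. 59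
(2001), §1 (the exterior sheet).
-/

-- the doubled `FinalStateConjecture` path component is the summit/problem naming scheme, not a mistake
set_option linter.dupNamespace false

noncomputable section

namespace Summit.FinalStateConjecture.FinalStateConjecture.Theorems.SwallowTheDatum.UniversalWitnessFamily

open scoped Manifold ContDiff Topology
open Bundle Set Filter Function Metric Literature.Geometry.Lorentzian Literature.Geometry.Manifold
open Summit.FinalStateConjecture.FinalStateConjecture.Theorems.SwallowTheDatum.ParametricKerrBurial

variable {X : Type} [TopologicalSpace X] [ChartedSpace E3 X] [IsManifold (𝓡 3) ∞ X]

/-! ## §1 The sheet shield is invariant under pullback by diffeomorphisms -/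

/-- **The sheet shield is invariant under pullback by a diffeomorphism.** Let `D` be sheet-shielded
(an open embedding `Φ` of the exterior sheet `{‖y‖ > M'/2}` with injective differentials and
co-compact far zones, `Φ^* D` = the time-symmetric exterior data) and let `Θ : X → X` be smooth with
injective differentials and with a smooth two-sided inverse `Ψ`. Then `Θ^* D = D.comap Θ` is
sheet-shielded: chart `Ψ ∘ Φ`, same mass; `(Ψ ∘ Φ)^*(Θ^* D) = (Θ ∘ Ψ ∘ Φ)^* D = Φ^* D`. [folklore] -/
theorem isSheetShielded_comap_of_inverse {D : InitialDataSet (𝓡 3) X}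
    (hD : ∃ (M' : ℝ) (hM' : 0 < M') (Φ : Schwarzschild.isotropicExterior M' → X)
      (hΦ : ContMDiff (𝓡 3) (𝓡 3) (∞ + 1) Φ) (hΦ' : ∀ u, Injective (mfderiv (𝓡 3) (𝓡 3) Φ u)),
      Topology.IsOpenEmbedding Φ ∧
      (∀ R' : ℝ, M' / 2 ≤ R' →
        IsCompact (Φ '' {y : Schwarzschild.isotropicExterior M' | R' < ‖(y : E3)‖})ᶜ) ∧
      D.comap Φ hΦ hΦ' = Schwarzschild.timeSymmetricExteriorData M' hM'.le)
    (Θ : X → X) (hΘ : ContMDiff (𝓡 3) (𝓡 3) (∞ + 1) Θ)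
    (hΘ' : ∀ u, Injective (mfderiv (𝓡 3) (𝓡 3) Θ u)) (Ψ : X → X)
    (hΨ : ContMDiff (𝓡 3) (𝓡 3) ∞ Ψ) (hΨΘ : ∀ x, Ψ (Θ x) = x) (hΘΨ : ∀ x, Θ (Ψ x) = x) :
    ∃ (M' : ℝ) (hM' : 0 < M') (Φ : Schwarzschild.isotropicExterior M' → X)
      (hΦ : ContMDiff (𝓡 3) (𝓡 3) (∞ + 1) Φ) (hΦ' : ∀ u, Injective (mfderiv (𝓡 3) (𝓡 3) Φ u)),
      Topology.IsOpenEmbedding Φ ∧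
      (∀ R' : ℝ, M' / 2 ≤ R' →
        IsCompact (Φ '' {y : Schwarzschild.isotropicExterior M' | R' < ‖(y : E3)‖})ᶜ) ∧
      (D.comap Θ hΘ hΘ').comap Φ hΦ hΦ' = Schwarzschild.timeSymmetricExteriorData M' hM'.le := by
  obtain ⟨M', hM', Φ, hΦ, hΦ', hemb, hcpt, hdata⟩ := hD
  have hΘs : ContMDiff (𝓡 3) (𝓡 3) ∞ Θ := hΘ.of_le le_self_add
  have hΦs : ContMDiff (𝓡 3) (𝓡 3) ∞ Φ := hΦ.of_le le_self_add
  -- `Θ` as a homeomorphism with inverse `Ψ`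
  let H : X ≃ₜ X :=
    { toFun := Θ
      invFun := Ψ
      left_inv := hΨΘ
      right_inv := hΘΨ
      continuous_toFun := hΘs.continuous
      continuous_invFun := hΨ.continuous }
  have hHsymm : ⇑H.symm = Ψ := rfl
  -- the differential of `Ψ` is injective (`dΘ ∘ dΨ = d(Θ ∘ Ψ) = d id = id`)
  have hΨinj : ∀ y : X, Injective (mfderiv (𝓡 3) (𝓡 3) Ψ y) := by
    intro y
    have hΘd : MDifferentiableAt (𝓡 3) (𝓡 3) Θ (Ψ y) := (hΘs _).mdifferentiableAt (by simp)
    have hΨd : MDifferentiableAt (𝓡 3) (𝓡 3) Ψ y := (hΨ y).mdifferentiableAt (by simp)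
    have h : mfderiv (𝓡 3) (𝓡 3) (Θ ∘ Ψ) y =
        (mfderiv (𝓡 3) (𝓡 3) Θ (Ψ y)).comp (mfderiv (𝓡 3) (𝓡 3) Ψ y) := mfderiv_comp y hΘd hΨd
    have hid : Θ ∘ Ψ = id := funext hΘΨ
    rw [hid, mfderiv_id] at h
    refine LeftInverse.injective (g := mfderiv (𝓡 3) (𝓡 3) Θ (Ψ y)) fun v ↦ ?_
    exact (DFunLike.congr_fun h v).symm
  -- the new sheet chart
  have hΦ₁s : ContMDiff (𝓡 3) (𝓡 3) ∞ (Ψ ∘ Φ) := hΨ.comp hΦs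
  have hΦ₁ : ContMDiff (𝓡 3) (𝓡 3) (∞ + 1) (Ψ ∘ Φ) := hΦ₁s
  have hΦ₁' : ∀ u, Injective (mfderiv (𝓡 3) (𝓡 3) (Ψ ∘ Φ) u) := by
    intro u
    have hΨd : MDifferentiableAt (𝓡 3) (𝓡 3) Ψ (Φ u) := (hΨ _).mdifferentiableAt (by simp)
    have hΦd : MDifferentiableAt (𝓡 3) (𝓡 3) Φ u := (hΦs u).mdifferentiableAt (by simp)
    rw [mfderiv_comp u hΨd hΦd]
    exact (hΨinj (Φ u)).comp (hΦ' u)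
  have hemb' : Topology.IsOpenEmbedding (Ψ ∘ Φ) := by
    rw [← hHsymm]
    exact H.symm.isOpenEmbedding.comp hemb
  have hcpt' : ∀ R' : ℝ, M' / 2 ≤ R' →
      IsCompact ((Ψ ∘ Φ) '' {y : Schwarzschild.isotropicExterior M' | R' < ‖(y : E3)‖})ᶜ := by
    intro R' hR'
    have hbij : Bijective Ψ := by rw [← hHsymm]; exact H.symm.bijective
    rw [Set.image_comp, ← Set.image_compl_eq hbij]
    exact (hcpt R' hR').image hΨ.continuous
  have hcomp : Θ ∘ (Ψ ∘ Φ) = Φ := funext fun y ↦ hΘΨ (Φ y)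
  -- the chain rule for the two pullbacks
  have hchain : ∀ (b : Π x : X, TangentSpace (𝓡 3) x →L[ℝ] TangentSpace (𝓡 3) x →L[ℝ] ℝ)
      (y : Schwarzschild.isotropicExterior M'),
      pullbackBilin (I := 𝓡 3) (I' := 𝓡 3) (Ψ ∘ Φ)
          (pullbackBilin (I := 𝓡 3) (I' := 𝓡 3) Θ b) y =
        pullbackBilin (I := 𝓡 3) (I' := 𝓡 3) Φ b y := by
    intro b y
    have hΘd : MDifferentiableAt (𝓡 3) (𝓡 3) Θ ((Ψ ∘ Φ) y) := (hΘs _).mdifferentiableAt (by simp)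
    have hφd : MDifferentiableAt (𝓡 3) (𝓡 3) (Ψ ∘ Φ) y := (hΦ₁s y).mdifferentiableAt (by simp)
    rw [← pullbackBilin_comp_apply_of_mdifferentiableAt hΘd hφd b, hcomp]
  refine ⟨M', hM', Ψ ∘ Φ, hΦ₁, hΦ₁', hemb', hcpt', ?_⟩
  rw [← hdata]
  refine InitialDataSet.ext' (fun u v w ↦ ?_) (fun u v w ↦ ?_)
  · -- metric clause: `(Ψ ∘ Φ)^*(Θ^* h) = Φ^* h`
    have hh₁ : ((D.comap Θ hΘ hΘ').comap (Ψ ∘ Φ) hΦ₁ hΦ₁').h.inner =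
        pullbackBilin (I := 𝓡 3) (I' := 𝓡 3) (Ψ ∘ Φ)
          (pullbackBilin (I := 𝓡 3) (I' := 𝓡 3) Θ D.h.inner) := rfl
    have hh₂ : (D.comap Φ hΦ hΦ').h.inner = pullbackBilin (I := 𝓡 3) (I' := 𝓡 3) Φ D.h.inner := rfl
    rw [hh₁, hh₂, hchain D.h.inner u]
  · -- second fundamental form clause: `(Ψ ∘ Φ)^*(Θ^* k) = Φ^* k`
    have hk₁ : ((D.comap Θ hΘ hΘ').comap (Ψ ∘ Φ) hΦ₁ hΦ₁').k =
        pullbackBilin (I := 𝓡 3) (I' := 𝓡 3) (Ψ ∘ Φ)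
          (pullbackBilin (I := 𝓡 3) (I' := 𝓡 3) Θ D.k) := rfl
    have hk₂ : (D.comap Φ hΦ hΦ').k = pullbackBilin (I := 𝓡 3) (I' := 𝓡 3) Φ D.k := rfl
    rw [hk₁, hk₂, hchain D.k u]

/-- **Breathing preserves the sheet shield**: for breathing data `B` and any `t`, the breathed datum
`breatheFamily B D t = (breathe (σ t))^* D` of a sheet-shielded `D` is sheet-shielded (`|σ t|` is
below the inverse threshold, so `breathe (σ t)` has a smooth inverse, `AFEndUnbreathe`). [folklore] -/
theorem isSheetShielded_breatheFamily [T2Space X] {e : AFEnd X} {z₀ : E3} {r : ℝ}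
    (B : AFEnd.BreathingData e z₀ r) {D : InitialDataSet (𝓡 3) X}
    (hD : ∃ (M' : ℝ) (hM' : 0 < M') (Φ : Schwarzschild.isotropicExterior M' → X)
      (hΦ : ContMDiff (𝓡 3) (𝓡 3) (∞ + 1) Φ) (hΦ' : ∀ u, Injective (mfderiv (𝓡 3) (𝓡 3) Φ u)),
      Topology.IsOpenEmbedding Φ ∧
      (∀ R' : ℝ, M' / 2 ≤ R' →
        IsCompact (Φ '' {y : Schwarzschild.isotropicExterior M' | R' < ‖(y : E3)‖})ᶜ) ∧
      D.comap Φ hΦ hΦ' = Schwarzschild.timeSymmetricExteriorData M' hM'.le) (t : ℝ) :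
    ∃ (M' : ℝ) (hM' : 0 < M') (Φ : Schwarzschild.isotropicExterior M' → X)
      (hΦ : ContMDiff (𝓡 3) (𝓡 3) (∞ + 1) Φ) (hΦ' : ∀ u, Injective (mfderiv (𝓡 3) (𝓡 3) Φ u)),
      Topology.IsOpenEmbedding Φ ∧
      (∀ R' : ℝ, M' / 2 ≤ R' →
        IsCompact (Φ '' {y : Schwarzschild.isotropicExterior M' | R' < ‖(y : E3)‖})ᶜ) ∧
      (AFEnd.breatheFamily B D t).comap Φ hΦ hΦ' = Schwarzschild.timeSymmetricExteriorData M' hM'.le := by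
  obtain ⟨Ψ, hΨ, h1, h2, -⟩ := AFEnd.exists_smooth_inverse_breathe B (AFEnd.abs_squash_lt_invScale B t)
  exact isSheetShielded_comap_of_inverse hD _ _ _ Ψ hΨ h1 h2

/-! ## §2 The stub -/

/-- **Stub `stub_sheetBreathing`** (registered signature, line `Sketch`, crux item
stmt-FinalStateConjecture-10051): the two-parameter family `S (R, t) = Φ_t^* (P R)`, the
one-parameter family `E t = Φ_t^* d` through `d`, and an injective marker, where `Φ_t` are the
breathing diffeomorphisms supported in a coordinate ball of the shell `{R < ‖coord‖ < R⋆}`; the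
sheet shield of `P R` is carried through `Φ_t` (`isSheetShielded_breatheFamily`). [folklore] -/
theorem stub_sheetBreathing :
  ∀ (X : Type) [TopologicalSpace X] [ChartedSpace E3 X] [IsManifold (𝓡 3) ∞ X] [T2Space X]
    [SecondCountableTopology X] [ConnectedSpace X] (d : InitialDataSet (𝓡 3) X) (e : AFEnd X) (Rstar : ℝ)
    (P : ℝ → InitialDataSet (𝓡 3) X), e.R < Rstar →
    SmoothSectionsOn 𝓘(ℝ, ℝ) P {p : ℝ × X | Rstar < p.1} →
    (∀ R : ℝ, Rstar < R → P R ∈ admissibleVacuumData X ∧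
      (∃ (M' : ℝ) (hM' : 0 < M') (Φ : Schwarzschild.isotropicExterior M' → X)
        (hΦ : ContMDiff (𝓡 3) (𝓡 3) (∞ + 1) Φ) (hΦ' : ∀ u, Function.Injective (mfderiv (𝓡 3) (𝓡 3) Φ u)),
        Topology.IsOpenEmbedding Φ ∧
        (∀ R' : ℝ, M' / 2 ≤ R' →
          IsCompact (Φ '' {y : Schwarzschild.isotropicExterior M' | R' < ‖(y : E3)‖})ᶜ) ∧
        (P R).comap Φ hΦ hΦ' = Schwarzschild.timeSymmetricExteriorData M' hM'.le) ∧
      ∀ x ∉ e.far R, AgreeAt (P R) d x) →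
    ∃ (S : ℝ × ℝ → InitialDataSet (𝓡 3) X) (E : ℝ → InitialDataSet (𝓡 3) X) (x₀ : X)
      (v₀ : TangentSpace (𝓡 3) x₀),
      SmoothSectionsOn (𝓘(ℝ, ℝ).prod 𝓘(ℝ, ℝ)) S {p : (ℝ × ℝ) × X | Rstar < p.1.1} ∧
      SmoothSectionsOn 𝓘(ℝ, ℝ) E (Set.univ : Set (ℝ × X)) ∧ E 0 = d ∧
      (∀ R t : ℝ, Rstar < R → ∀ x ∉ e.far R, AgreeAt (S (R, t)) (E t) x) ∧ x₀ ∉ e.far Rstar ∧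
      Set.InjOn (fun t : ℝ ↦ (E t).h.inner x₀ v₀ v₀) (Set.Ioo (-1) 1) ∧
      ∀ R t : ℝ, Rstar < R → |t| < 1 → S (R, t) ∈ admissibleVacuumData X ∧
        ∃ (M' : ℝ) (hM' : 0 < M') (Φ : Schwarzschild.isotropicExterior M' → X)
          (hΦ : ContMDiff (𝓡 3) (𝓡 3) (∞ + 1) Φ) (hΦ' : ∀ u, Function.Injective (mfderiv (𝓡 3) (𝓡 3) Φ u)),
          Topology.IsOpenEmbedding Φ ∧
          (∀ R' : ℝ, M' / 2 ≤ R' →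
            IsCompact (Φ '' {y : Schwarzschild.isotropicExterior M' | R' < ‖(y : E3)‖})ᶜ) ∧
          (S (R, t)).comap Φ hΦ hΦ' = Schwarzschild.timeSymmetricExteriorData M' hM'.le := by
  intro X _ _ _ _ _ _ d e Rstar P hR hP hPR
  -- the breathing ball and the breathing families
  obtain ⟨z₀, r, B, hzr⟩ := exists_breathingData_le e hR
  let E : ℝ → InitialDataSet (𝓡 3) X := fun t ↦ AFEnd.breatheFamily B d t
  let S : ℝ × ℝ → InitialDataSet (𝓡 3) X := fun q ↦ AFEnd.breatheFamily B (P q.1) q.2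
  let x₀ : X := e.dataChartExt z₀
  let v₀ : TangentSpace (𝓡 3) x₀ := (EuclideanSpace.single 0 1 : E3)
  have hv₀ : v₀ ≠ 0 := by
    intro h
    have h1 : ‖(EuclideanSpace.single (0 : Fin 3) (1 : ℝ) : E3)‖ = 1 := by simp
    have h2 : (EuclideanSpace.single (0 : Fin 3) (1 : ℝ) : E3) = 0 := h
    rw [h2, norm_zero] at h1
    exact zero_ne_one h1
  -- `P R = d` on the carrier (`R > R⋆`), and at breathed points of the complement of `far R`
  have hcarrier : ∀ {R : ℝ}, Rstar < R → ∀ {x : X}, x ∈ e.breatheCarrier z₀ r → x ∉ e.far R :=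
    fun hRR _ hx ↦ not_mem_far_of_mem_carrier e hzr hRR.le hx
  have hagree_breathe : ∀ {R : ℝ}, Rstar < R → ∀ (t : ℝ) {x : X}, x ∉ e.far R →
      AgreeAt (P R) d (e.breathe z₀ r (AFEnd.squash B t) x) := by
    intro R hRR t x hx
    refine (hPR R hRR).2.2 _ ?_
    by_cases hxc : x ∈ e.breatheCarrier z₀ r
    · exact hcarrier hRR
        ⟨(AFEnd.breathe_mem_and_coord B (AFEnd.abs_squash_lt_scale B t).2 hxc).1, by
          rw [(AFEnd.breathe_mem_and_coord B (AFEnd.abs_squash_lt_scale B t).2 hxc).2]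
          exact AFEnd.phi_mem_ball_of_lt_invScale (AFEnd.abs_squash_lt_invScale B t) hxc.2⟩
    · rwa [e.breathe_of_not_mem hxc]
  -- `S (R, t)` and `E t` agree wherever `P R` and `d` agree at the breathed point
  have hSE : ∀ {R : ℝ} (t : ℝ) {x : X}, AgreeAt (P R) d (e.breathe z₀ r (AFEnd.squash B t) x) →
      AgreeAt (S (R, t)) (E t) x := by
    intro R t x hag
    refine ⟨?_, ?_⟩
    · ext v w
      rw [AFEnd.breatheFamily_h_inner, AFEnd.breatheFamily_h_inner, hag.1]
    · ext v w
      rw [AFEnd.breatheFamily_k, AFEnd.breatheFamily_k, hag.2]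
  -- the section maps of `E`
  have hEh := AFEnd.contMDiff_breatheFamily_h B d
  have hEk := AFEnd.contMDiff_breatheFamily_k B d
  refine ⟨S, E, x₀, v₀, ?_, ⟨hEh.contMDiffOn, hEk.contMDiffOn⟩, AFEnd.breatheFamily_zero B d,
    fun R t hRR x hx ↦ hSE t (hagree_breathe hRR t hx), ?_, ?_, fun R t hRR _ ↦ ⟨?_, ?_⟩⟩
  · -- joint smoothness of `S` on `{R⋆ < R}`
    have hopen : IsOpen {p : (ℝ × ℝ) × X | Rstar < p.1.1} :=
      isOpen_lt continuous_const (continuous_fst.comp continuous_fst)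
    have hproj₂ : ContMDiff ((𝓘(ℝ, ℝ).prod 𝓘(ℝ, ℝ)).prod (𝓡 3)) (𝓘(ℝ, ℝ).prod (𝓡 3)) ∞
        (fun q : (ℝ × ℝ) × X ↦ (q.1.2, q.2)) :=
      (contMDiff_snd.comp contMDiff_fst).prodMk contMDiff_snd
    have hproj₁ : ContMDiff ((𝓘(ℝ, ℝ).prod 𝓘(ℝ, ℝ)).prod (𝓡 3)) (𝓘(ℝ, ℝ).prod (𝓡 3)) ∞
        (fun q : (ℝ × ℝ) × X ↦ (q.1.1, q.2)) :=
      (contMDiff_fst.comp contMDiff_fst).prodMk contMDiff_snd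
    -- generic argument for a section `sec` (`h` or `k`)
    have key : ∀ (secS : Π q : (ℝ × ℝ) × X, TangentSpace (𝓡 3) q.2 →L[ℝ] TangentSpace (𝓡 3) q.2 →L[ℝ] ℝ)
        (secE : Π q : ℝ × X, TangentSpace (𝓡 3) q.2 →L[ℝ] TangentSpace (𝓡 3) q.2 →L[ℝ] ℝ)
        (secP : Π q : ℝ × X, TangentSpace (𝓡 3) q.2 →L[ℝ] TangentSpace (𝓡 3) q.2 →L[ℝ] ℝ),
        ContMDiff (𝓘(ℝ, ℝ).prod (𝓡 3)) ((𝓡 3).prod 𝓘(ℝ, E3 →L[ℝ] E3 →L[ℝ] ℝ)) ∞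
          (fun q : ℝ × X ↦ TotalSpace.mk' (E3 →L[ℝ] E3 →L[ℝ] ℝ)
            (E := fun x : X ↦ TangentSpace (𝓡 3) x →L[ℝ] TangentSpace (𝓡 3) x →L[ℝ] ℝ) q.2 (secE q)) →
        ContMDiffOn (𝓘(ℝ, ℝ).prod (𝓡 3)) ((𝓡 3).prod 𝓘(ℝ, E3 →L[ℝ] E3 →L[ℝ] ℝ)) ∞
          (fun q : ℝ × X ↦ TotalSpace.mk' (E3 →L[ℝ] E3 →L[ℝ] ℝ)
            (E := fun x : X ↦ TangentSpace (𝓡 3) x →L[ℝ] TangentSpace (𝓡 3) x →L[ℝ] ℝ) q.2 (secP q))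
          {p : ℝ × X | Rstar < p.1} →
        (∀ q : (ℝ × ℝ) × X, Rstar < q.1.1 → q.2 ∈ e.breatheCarrier z₀ r → secS q = secE (q.1.2, q.2)) →
        (∀ q : (ℝ × ℝ) × X, q.2 ∉ AFEnd.breatheCore e z₀ r → secS q = secP (q.1.1, q.2)) →
        ContMDiffOn ((𝓘(ℝ, ℝ).prod 𝓘(ℝ, ℝ)).prod (𝓡 3)) ((𝓡 3).prod 𝓘(ℝ, E3 →L[ℝ] E3 →L[ℝ] ℝ)) ∞
          (fun q : (ℝ × ℝ) × X ↦ TotalSpace.mk' (E3 →L[ℝ] E3 →L[ℝ] ℝ)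
            (E := fun x : X ↦ TangentSpace (𝓡 3) x →L[ℝ] TangentSpace (𝓡 3) x →L[ℝ] ℝ) q.2 (secS q))
          {p : (ℝ × ℝ) × X | Rstar < p.1.1} := by
      intro secS secE secP hE hP hcar hcore q hq
      have hq' : Rstar < q.1.1 := hq
      apply ContMDiffAt.contMDiffWithinAt
      by_cases hx : q.2 ∈ e.breatheCarrier z₀ r
      · -- on the carrier `S = E`
        have hsm : ContMDiffAt ((𝓘(ℝ, ℝ).prod 𝓘(ℝ, ℝ)).prod (𝓡 3)) ((𝓡 3).prod 𝓘(ℝ, E3 →L[ℝ] E3 →L[ℝ] ℝ)) ∞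
            (fun q : (ℝ × ℝ) × X ↦ TotalSpace.mk' (E3 →L[ℝ] E3 →L[ℝ] ℝ)
              (E := fun x : X ↦ TangentSpace (𝓡 3) x →L[ℝ] TangentSpace (𝓡 3) x →L[ℝ] ℝ) q.2
                (secE (q.1.2, q.2))) q :=
          (hE (q.1.2, q.2)).comp q (hproj₂ q)
        refine hsm.congr_of_eventuallyEq ?_
        have hev₁ : ∀ᶠ p : (ℝ × ℝ) × X in 𝓝 q, Rstar < p.1.1 := hopen.mem_nhds hq'
        have hev₂ : ∀ᶠ p : (ℝ × ℝ) × X in 𝓝 q, p.2 ∈ e.breatheCarrier z₀ r :=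
          (continuousAt_snd (p := q)).preimage_mem_nhds ((e.isOpen_breatheCarrier z₀ r).mem_nhds hx)
        have hev := hev₁.and hev₂
        filter_upwards [hev] with p hp
        rw [hcar p hp.1 hp.2]
      · -- off the carrier, hence off the moved set: `S = P`
        have hK : q.2 ∉ AFEnd.breatheCore e z₀ r := fun h ↦ hx (AFEnd.breatheCore_subset_carrier B h)
        have hmem : (q.1.1, q.2) ∈ {p : ℝ × X | Rstar < p.1} := hq'
        have hPat : ContMDiffAt (𝓘(ℝ, ℝ).prod (𝓡 3)) ((𝓡 3).prod 𝓘(ℝ, E3 →L[ℝ] E3 →L[ℝ] ℝ)) ∞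
            (fun q : ℝ × X ↦ TotalSpace.mk' (E3 →L[ℝ] E3 →L[ℝ] ℝ)
              (E := fun x : X ↦ TangentSpace (𝓡 3) x →L[ℝ] TangentSpace (𝓡 3) x →L[ℝ] ℝ) q.2 (secP q))
            (q.1.1, q.2) :=
          (hP _ hmem).contMDiffAt ((isOpen_lt continuous_const continuous_fst).mem_nhds hmem)
        have hsm : ContMDiffAt ((𝓘(ℝ, ℝ).prod 𝓘(ℝ, ℝ)).prod (𝓡 3)) ((𝓡 3).prod 𝓘(ℝ, E3 →L[ℝ] E3 →L[ℝ] ℝ)) ∞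
            (fun q : (ℝ × ℝ) × X ↦ TotalSpace.mk' (E3 →L[ℝ] E3 →L[ℝ] ℝ)
              (E := fun x : X ↦ TangentSpace (𝓡 3) x →L[ℝ] TangentSpace (𝓡 3) x →L[ℝ] ℝ) q.2
                (secP (q.1.1, q.2))) q :=
          hPat.comp q (hproj₁ q)
        refine hsm.congr_of_eventuallyEq ?_
        have hev : ∀ᶠ p : (ℝ × ℝ) × X in 𝓝 q, p.2 ∉ AFEnd.breatheCore e z₀ r :=
          (continuousAt_snd (p := q)).preimage_mem_nhds
            ((AFEnd.isCompact_breatheCore B).isClosed.isOpen_compl.mem_nhds hK)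
        filter_upwards [hev] with p hp
        rw [hcore p hp]
    refine ⟨key (fun q ↦ (S q.1).h.inner q.2) (fun q ↦ (E q.1).h.inner q.2) (fun q ↦ (P q.1).h.inner q.2)
        hEh hP.1 (fun q hq hx ↦ ?_) (fun q hx ↦ ?_),
      key (fun q ↦ (S q.1).k q.2) (fun q ↦ (E q.1).k q.2) (fun q ↦ (P q.1).k q.2)
        hEk hP.2 (fun q hq hx ↦ ?_) (fun q hx ↦ ?_)⟩
    · exact (hSE q.1.2 (hagree_breathe hq q.1.2 (hcarrier hq hx))).1
    · exact (AFEnd.breatheFamily_eq_of_not_mem_core B (P q.1.1) q.1.2 hx).1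
    · exact (hSE q.1.2 (hagree_breathe hq q.1.2 (hcarrier hq hx))).2
    · exact (AFEnd.breatheFamily_eq_of_not_mem_core B (P q.1.1) q.1.2 hx).2
  · -- the marker point lies below `R⋆`
    exact not_mem_far_of_mem_carrier e hzr le_rfl (AFEnd.center_mem B).1
  · -- the marker is injective
    exact (AFEnd.injective_marker B d hv₀).injOn
  · -- admissibility of `S (R, t)`
    obtain ⟨hPadm, -, -⟩ := hPR R hRR
    have hvacP : ∀ [(P R).metric.HasLeviCivita], (P R).IsVacuumConstraintSolution := fun {inst} ↦ (hPadm.1).1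
    refine InitialDataSet.mem_admissibleVacuumData_of_agree_off_compact hPadm ?_
      (AFEnd.isCompact_breatheCore B) (fun x hx ↦ AFEnd.breatheFamily_eq_of_not_mem_core B (P R) t hx)
    intro inst
    haveI : (P R).metric.HasLeviCivita := (P R).metric.hasLeviCivita
    exact AFEnd.isVacuumConstraintSolution_breatheFamily B (P R) hvacP t
  · -- the sheet shield of `S (R, t)`
    exact isSheetShielded_breatheFamily B (hPR R hRR).2.1 t

end Summit.FinalStateConjecture.FinalStateConjecture.Theorems.SwallowTheDatum.UniversalWitnessFamily

end
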